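import Literature.MathematicalPhysics.QuantumFieldTheory.Balaban1983to89.T4AxialGaugeFixing
import HarnessLib

/-!
# The axial gauge of a box READS ONLY THE COMB: adaptedness to off-comb bond updates, measurability, comb-triviality
# — docking rows for LINE 28 «gross-sd-transfer», construction C3 «tree-gauge dressing» (crux `HistoryTailL`, stmt-QuantumFields-19936)

Cell `ym3-torus` (YM ladder rung R3 = continuum SU(2) Yang–Mills on T³ — a RUNG, NOT the Clay problem: not d = 4, not infinite
volume, not a mass gap); width seat `ym3-torus-px5` g10.  Helper `--supports stmt-QuantumFields-19936`; THEOREMS ONLY (0 `def`,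
0 `sorry`, default heartbeats).  Everything is over the tree's torus carrier `GaugeField P j G` of `Setup`, the `ℤ^d` word machinery of
`B7Prop1Explicit` ∕ `B8Lemma1NonAbelian` (`hol`, `treeWord`, `axialFn`, `lowPart`, `axial_treeBond_eq_one`), the torus axial gauge
`T4AxialGaugeSmallField.axialGauge U lo hi` (the transporter `axialFn (pull U) lo` rooted at the corner `lo`, read through `castSite`)
and the comb `T4AxialGaugeFixing.combSet lo hi` — all used BY NAME, nothing re-defined.

WHY (ideator ym-r3-idea-2 g15, `Cruxes/HistoryTailL/GrossTransferAnnex4.md` §0 C3 «SD STEP» and §6 `stub_condSD`; w8-19936 g10's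
(SD-DRESS) `UnitScaleGibbsDressedSchwingerDyson`, px8 g9's ✓`UnitScaleGibbsOneBondSchwingerDysonAdapted`).  The dressed
Schwinger–Dyson identity flows a NON-tree bond `b` along the ADAPTED family `k U t := (g U b.src)⁻¹ · e t · g U b.src` with the
dressing `g U := axialGauge U lo hi`; the adapted one-bond engine (✓`integral_shiftDeriv_eq_gibbsMeasure_adapted`) asks exactly
(`hkb`) `k (U[b ↦ x]) = k U` and (`hkm`) `U ↦ k U t` measurable.  Both are properties of the DRESSING, and this file proves them
for the concrete axial gauge of a box, together with the bookkeeping «the dressed field is `1` on the comb»: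

* §1 (`ℤ^d`, any group) ★`axialFn_congr_of_comb`: two configurations that agree on the comb bonds of `[lo, hi]`
  (`lo ≤ x`, `x + e_μ ≤ hi`, `lowPart μ (x − lo) = 0`) have the same axial gauge function on the box — by induction on the depth
  `Σ_κ (x_κ − lo_κ)` through the tree-bond identity `axial_treeBond_eq_one` (the pattern of ✓`T4AxialGaugeFixing.axialFn_eq_one_of_comb`).
* §2 (torus) ★★`axialGauge_congr_of_comb`: `(∀ b ∈ combSet lo hi, U b = U' b) → axialGauge U lo hi = axialGauge U' lo hi`
  (NO non-wrapping hypothesis), whence ★★`axialGauge_update_of_not_mem_combSet`: `b ∉ combSet lo hi →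
  axialGauge (Function.update U b c) lo hi = axialGauge U lo hi` — the row `hkb`∕`hgb` for EVERY off-comb bond (in the box or not);
  `not_mem_combSet_of_(inner_)lowPart_ne_zero`, `nonWrapping_of_side_lt`: the support rows of LINE 28's skeleton v1 `stub_condSD`
  (`b.src = castSite x`, `lowPart b.dir (x − lo) ≠ 0`, box `lo ≤ hi ≤ lo + n`, `n < sitesPerDir`) ARE off-comb bonds of a non-wrapping box.
* §3 (torus) ★`measurable_hol_pull`, ★`measurable_axialGauge_apply` (sitewise), `measurable_axialGauge` (as a map into
  `Site P j → G`), ★`measurable_gaugeAct_axialGauge` (the dressed field `U ↦ U^{axialGauge U}` is measurable) and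
  `measurable_conj_axialGauge` (`U ↦ (g U s)⁻¹ · c · g U s`, the row `hkm`) — `[MeasurableMul₂ G] [MeasurableInv G]`, i.e. the
  tree's `RegularGaugeGroup`.
* §4 (torus, NON-WRAPPING box) `gaugeAct_axialGauge_eq_one_of_mem_combSet`: the dressed field is `1` on every comb bond
  (✓`T4AxialGaugeSmallField.gaugeAct_axialGauge_eq_one` read through `combSet`).

HONEST SCOPE.  Docking infrastructure (locality ∕ measurability of a gauge fixing); nothing of the dressed Schwinger–Dyson identity
itself (w8-19936 g10), of C3's Hessian rows, of `stub_lin` ∕ `stub_test`, of «ShallowFluxSecondMomentL» ∕ (Q) ∕ K1 ∕ `MeanDeviationL` ∕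
`HistoryTailL`, of the rung R3, d = 4, a continuum limit or a mass gap is proved here; the Yang–Mills mass gap is NOT proved.

References: T. Bałaban, CMP 98 (1985) 17–51, p. 24 (the axial gauge `V(Γ_{y,x})`) [Balaban1985Averaging]; M. Creutz, Quarks, Gluons
and Lattices (1983∕2022) Ch. 11 [Creutz2022].
-/

noncomputable section

open MeasureTheory Finset
open Literature.MathematicalPhysics.QuantumFieldTheory.Balaban1983to89
open Literature.MathematicalPhysics.QuantumFieldTheory.Balaban1983to89.B7Prop1Explicit
  (Letter e e_apply hol hol_nil hol_cons stepHol treeWord axialFn gaugeAct)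
open Literature.MathematicalPhysics.QuantumFieldTheory.Balaban1983to89.B8Lemma1NonAbelian
  (lowPart lowPart_apply e_nonneg axial_treeBond_eq_one)
open Literature.MathematicalPhysics.QuantumFieldTheory.Balaban1983to89.T4AxialGaugeSmallField
  (castSite castSite_add_e pull pull_apply axialGauge gaugeAct_axialGauge_eq_one boxBonds)
open Literature.MathematicalPhysics.QuantumFieldTheory.Balaban1983to89.T4AxialGaugeFixing
  (combSet combSet_subset_boxBonds sum_e_apply)

namespace Summit.QuantumFields.YangMills.Theorems.UnitScaleGibbsAxialGaugeDocking

/-! ## §1  `ℤ^d`: the axial gauge function on the box reads only the comb bonds -/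

section TreeLevel

variable {d : ℕ} {G : Type*} [Group G]

/-- ★ **TWO CONFIGURATIONS THAT AGREE ON THE COMB HAVE THE SAME AXIAL GAUGE FUNCTION ON THE BOX** (`ℤ^d` level, any group):
if `V(x, μ) = V'(x, μ)` on every comb bond of `[lo, hi]` (`lo ≤ x`, `x + e_μ ≤ hi`, `x_κ = lo_κ` for `κ < μ`) then
`axialFn V lo x = axialFn V' lo x` for every box point `x`.  Induction on the depth `Σ_κ (x_κ − lo_κ)`: the parent of `x ≠ lo` along
the comb is `x − e_μ` (`μ` = the first direction in which `x` differs from `lo`), `⟨x − e_μ, μ⟩` is a comb bond, and the tree-bond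
identity `axial_treeBond_eq_one` reads `axialFn(x − e_μ) · V(x − e_μ, μ) · axialFn(x)⁻¹ = 1` for both configurations.
[cite: Balaban1985Averaging, p.24] -/
theorem axialFn_congr_of_comb (V V' : (Fin d → ℤ) → Fin d → G) {lo hi : Fin d → ℤ}
    (hV : ∀ (x : Fin d → ℤ) (μ : Fin d), lo ≤ x → x + e μ ≤ hi → lowPart μ (x - lo) = 0 → V x μ = V' x μ)
    {x : Fin d → ℤ} (hx : lo ≤ x) (hx' : x ≤ hi) : axialFn V lo x = axialFn V' lo x := by
  suffices H : ∀ (n : ℕ) (x : Fin d → ℤ), lo ≤ x → x ≤ hi → ∑ κ, (x κ - lo κ) < n → axialFn V lo x = axialFn V' lo x from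
    H ((∑ κ, (x κ - lo κ)).toNat + 1) x hx hx' (by push_cast; linarith [Int.self_le_toNat (∑ κ, (x κ - lo κ))])
  intro n
  induction n with
  | zero =>
    intro x hx _ hlt
    have h0 : (0 : ℤ) ≤ ∑ κ, (x κ - lo κ) := sum_nonneg fun κ _ => sub_nonneg.2 (hx κ)
    push_cast at hlt
    linarith
  | succ n ih =>
    intro x hx hx' hlt
    by_cases hxlo : x = lo
    · subst hxlo; simp [axialFn]
    · -- `μ` := the first direction in which `x` differs from `lo`
      have hS : (univ.filter fun κ => x κ ≠ lo κ).Nonempty := by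
        by_contra h
        rw [not_nonempty_iff_eq_empty, filter_eq_empty_iff] at h
        exact hxlo (funext fun κ => by simpa using h (mem_univ κ))
      set μ := (univ.filter fun κ => x κ ≠ lo κ).min' hS with hμdef
      have hμ : x μ ≠ lo μ := (mem_filter.1 (min'_mem _ hS)).2
      have hmin : ∀ κ, κ < μ → x κ = lo κ := fun κ hκ => by
        by_contra hne
        exact (not_le.2 hκ) (min'_le _ _ (mem_filter.2 ⟨mem_univ κ, hne⟩))
      -- the parent `x − e_μ` is a box point and `⟨x − e_μ, μ⟩` is a comb bond
      have hz1 : lo ≤ x - e μ := by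
        intro κ
        show lo κ ≤ (x - e μ) κ
        simp only [Pi.sub_apply, e_apply]
        split_ifs with hκ
        · have hlt' : lo κ < x κ := lt_of_le_of_ne (hx κ) fun h => hμ (by rw [← hκ]; exact h.symm)
          omega
        · simpa using hx κ
      have hz' : x - e μ ≤ hi := (sub_le_self x (e_nonneg μ)).trans hx'
      have hlow : lowPart μ (x - e μ - lo) = 0 := by
        funext κ
        by_cases hκ : κ < μ
        · simp [lowPart_apply, hκ, e_apply, ne_of_lt hκ, hmin κ hκ]
        · simp [lowPart_apply, hκ]
      have hVz : V (x - e μ) μ = V' (x - e μ) μ := hV _ μ hz1 (by rw [sub_add_cancel]; exact hx') hlow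
      have hsum : ∑ κ, ((x - e μ) κ - lo κ) = ∑ κ, (x κ - lo κ) - 1 := by
        simp only [Pi.sub_apply]
        rw [show ∑ κ, (x κ - e μ κ - lo κ) = ∑ κ, ((x κ - lo κ) - e μ κ) from sum_congr rfl fun κ _ => by ring,
          sum_sub_distrib, sum_e_apply]
      have hIH : axialFn V lo (x - e μ) = axialFn V' lo (x - e μ) :=
        ih _ hz1 hz' (by rw [hsum]; push_cast at hlt ⊢; linarith)
      -- the tree-bond identity for both configurations: `axialFn(x − e_μ) · V(x − e_μ, μ) · axialFn(x)⁻¹ = 1`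
      have htree := axial_treeBond_eq_one V lo (x - e μ) μ hlow
      have htree' := axial_treeBond_eq_one V' lo (x - e μ) μ hlow
      simp only [B7Prop1Explicit.gaugeAct, sub_add_cancel] at htree htree'
      -- solve both for `axialFn _ lo x`
      have h1 : axialFn V lo x = axialFn V lo (x - e μ) * V (x - e μ) μ := by
        have := htree
        rw [mul_inv_eq_one] at this
        exact this.symm
      have h2 : axialFn V' lo x = axialFn V' lo (x - e μ) * V' (x - e μ) μ := by
        have := htree'
        rw [mul_inv_eq_one] at this
        exact this.symm
      rw [h1, h2, hIH, hVz]

end TreeLevel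

/-! ## §2  Torus: `axialGauge U lo hi` reads only `U` on the comb — adaptedness to off-comb updates -/

section Torus

variable {P : Params} {j : ℕ} {G : Type*} [GaugeGroup G]

/-- ★★ **THE TORUS AXIAL GAUGE READS ONLY THE COMB**: if `U = U'` on `combSet lo hi` then `axialGauge U lo hi = axialGauge U' lo hi`
(as gauge transformations of the whole torus; no non-wrapping hypothesis is needed — both sides evaluate the same `ℤ^d` transporter
`axialFn (pull ·) lo` at the same chosen box preimage, and off the image of the box both are `1`). [cite: Balaban1985Averaging, p.24] -/
theorem axialGauge_congr_of_comb (U U' : GaugeField P j G) {lo hi : Fin P.d → ℤ}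
    (hU : ∀ b ∈ combSet lo hi, U b = U' b) : axialGauge U lo hi = axialGauge U' lo hi := by
  funext s
  rw [axialGauge, axialGauge]
  by_cases h : ∃ x : Fin P.d → ℤ, lo ≤ x ∧ x ≤ hi ∧ (castSite x : Site P j) = s
  · rw [dif_pos h, dif_pos h]
    obtain ⟨h1, h2, _⟩ := Classical.choose_spec h
    exact axialFn_congr_of_comb (pull U) (pull U')
      (fun x μ hx hxμ hlow => hU ⟨castSite x, μ⟩ ⟨x, hx, hxμ, rfl, hlow⟩) h1 h2
  · rw [dif_neg h, dif_neg h]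

/-- ★★ **ADAPTEDNESS TO OFF-COMB BOND UPDATES** (the row `hkb`∕`hgb` of the adapted one-bond Schwinger–Dyson engine at C3's
dressing): for every bond `b ∉ combSet lo hi` — in particular every NON-tree bond of the box, and every bond outside the box — and
every `c`, `axialGauge (U[b ↦ c]) lo hi = axialGauge U lo hi`. [cite: Creutz2022, Ch. 11] -/
theorem axialGauge_update_of_not_mem_combSet [DecidableEq (PBond P j)] (U : GaugeField P j G) {lo hi : Fin P.d → ℤ}
    {b : PBond P j} (hb : b ∉ combSet lo hi) (c : G) :
    axialGauge (Function.update U b c) lo hi = axialGauge U lo hi :=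
  axialGauge_congr_of_comb _ _ fun b' hb' => by
    rw [Function.update_of_ne]
    rintro rfl
    exact hb hb'

/-- The same for the transporter at ONE site (the form in which `k U t := (g U b.src)⁻¹ · e t · g U b.src` uses it).
[cite: Creutz2022, Ch. 11] -/
theorem axialGauge_update_apply_of_not_mem_combSet [DecidableEq (PBond P j)] (U : GaugeField P j G) {lo hi : Fin P.d → ℤ}
    {b : PBond P j} (hb : b ∉ combSet lo hi) (c : G) (s : Site P j) :
    axialGauge (Function.update U b c) lo hi s = axialGauge U lo hi s := by
  rw [axialGauge_update_of_not_mem_combSet U hb c]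

/-- **OFF-TREE BOX BONDS ARE OFF THE COMB** (the support row of LINE 28's `stub_condSD` ∕ `stub_hessOnEvent`, which describe the
test field's bonds as `b.src = castSite x`, `lo ≤ x`, `x + e_{b.dir} ≤ hi`, `lowPart b.dir (x − lo) ≠ 0`): on a NON-WRAPPING box such a
bond is not a comb bond (`castSite` is injective on the box, so the comb witness would be `x` itself). [folklore] -/
theorem not_mem_combSet_of_lowPart_ne_zero {lo hi : Fin P.d → ℤ} (hN : ∀ κ, hi κ - lo κ < P.sitesPerDir j)
    {b : PBond P j} {x : Fin P.d → ℤ} (hx : lo ≤ x) (hxμ : x + e b.dir ≤ hi) (hsrc : b.src = castSite x)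
    (hlow : lowPart b.dir (x - lo) ≠ 0) : b ∉ combSet lo hi := by
  rintro ⟨x', hx'lo, hx'hi, hsrc', hlow'⟩
  have hxhi : x ≤ hi := (le_add_of_nonneg_right (e_nonneg _)).trans hxμ
  have hx'hi' : x' ≤ hi := (le_add_of_nonneg_right (e_nonneg _)).trans hx'hi
  have hxx' : x' = x :=
    T4AxialGaugeSmallField.castSite_injOn_box hN hx'lo hx'hi' hx hxhi (hsrc'.symm.trans hsrc)
  exact hlow (hxx' ▸ hlow')

/-- The same with the INNER margin of LINE 28's skeleton (`lo + 1 ≤ x`, `x + e_{b.dir} + 1 ≤ hi`). [folklore] -/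
theorem not_mem_combSet_of_inner_lowPart_ne_zero {lo hi : Fin P.d → ℤ} (hN : ∀ κ, hi κ - lo κ < P.sitesPerDir j)
    {b : PBond P j} {x : Fin P.d → ℤ} (hx : lo + 1 ≤ x) (hxμ : x + e b.dir + 1 ≤ hi) (hsrc : b.src = castSite x)
    (hlow : lowPart b.dir (x - lo) ≠ 0) : b ∉ combSet lo hi := by
  refine not_mem_combSet_of_lowPart_ne_zero hN (fun κ => ?_) (fun κ => ?_) hsrc hlow
  · have h := hx κ
    simp only [Pi.add_apply, Pi.one_apply] at h
    linarith
  · have h := hxμ κ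
    simp only [Pi.add_apply, Pi.one_apply] at h ⊢
    linarith

/-- A box of side `n < sitesPerDir j` (`lo ≤ hi ≤ lo + n`, the shape of LINE 28's stubs) does not wrap. [folklore] -/
theorem nonWrapping_of_side_lt {lo hi : Fin P.d → ℤ} {n : ℕ} (hbox : ∀ κ, lo κ ≤ hi κ ∧ hi κ ≤ lo κ + n)
    (hn : n < P.sitesPerDir j) : ∀ κ, hi κ - lo κ < P.sitesPerDir j := fun κ => by
  have h := (hbox κ).2
  have hn' : (n : ℤ) < P.sitesPerDir j := by exact_mod_cast hn
  linarith

/-- Off-comb box bonds are off the comb (bookkeeping for `b ∈ boxBonds lo hi`, `b ∉ combSet lo hi`): the adapted family built on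
the axial gauge is adapted at every such bond. [cite: Creutz2022, Ch. 11] -/
theorem axialGauge_update_of_mem_boxBonds_diff [DecidableEq (PBond P j)] (U : GaugeField P j G) {lo hi : Fin P.d → ℤ}
    {b : PBond P j} (hb : b ∈ boxBonds lo hi \ combSet lo hi) (c : G) :
    axialGauge (Function.update U b c) lo hi = axialGauge U lo hi :=
  axialGauge_update_of_not_mem_combSet U hb.2 c

end Torus

/-! ## §3  Measurability of the axial gauge and of the dressed field -/

section Measurability

variable {P : Params} {j : ℕ} {G : Type*} [GaugeGroup G] [MeasurableSpace G] [MeasurableMul₂ G] [MeasurableInv G]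

omit [MeasurableMul₂ G] in
/-- One step of parallel transport of the pullback, `U ↦ stepHol (pull U) z l`, is measurable (a coordinate of `U` or its inverse).
[folklore] -/
theorem measurable_stepHol_pull (z : Fin P.d → ℤ) (l : Letter P.d) :
    Measurable fun U : GaugeField P j G => stepHol (pull U) z l := by
  unfold stepHol
  by_cases hl : l.2 = true
  · simp only [hl, if_true, pull_apply]
    exact measurable_pi_apply (⟨castSite z, l.1⟩ : PBond P j)
  · simp only [hl, pull_apply]
    exact (measurable_pi_apply (⟨castSite (z + l.vec), l.1⟩ : PBond P j)).inv

/-- ★ Parallel transport of the pullback along any word, `U ↦ hol (pull U) z w`, is measurable (finite product of coordinates and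
inverses of coordinates). [folklore] -/
theorem measurable_hol_pull : ∀ (w : List (Letter P.d)) (z : Fin P.d → ℤ),
    Measurable fun U : GaugeField P j G => hol (pull U) z w
  | [], z => by simp only [hol_nil]; exact measurable_const
  | l :: w, z => by
    simp only [hol_cons]
    exact (measurable_stepHol_pull z l).mul (measurable_hol_pull w (z + l.vec))

/-- The `ℤ^d` axial gauge function of the pullback at a point, `U ↦ axialFn (pull U) lo x`, is measurable. [folklore] -/
theorem measurable_axialFn_pull (lo x : Fin P.d → ℤ) :
    Measurable fun U : GaugeField P j G => axialFn (pull U) lo x :=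
  measurable_hol_pull (treeWord (x - lo)) lo

/-- ★ **THE TORUS AXIAL GAUGE IS MEASURABLE, SITEWISE**: `U ↦ axialGauge U lo hi s` is measurable for every site `s`
(the case split «`s` in the image of the box» does not depend on `U`). [folklore] -/
theorem measurable_axialGauge_apply (lo hi : Fin P.d → ℤ) (s : Site P j) :
    Measurable fun U : GaugeField P j G => axialGauge U lo hi s := by
  by_cases h : ∃ x : Fin P.d → ℤ, lo ≤ x ∧ x ≤ hi ∧ (castSite x : Site P j) = s
  · have : (fun U : GaugeField P j G => axialGauge U lo hi s) =
        fun U => axialFn (pull U) lo (Classical.choose h) := by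
      funext U; rw [axialGauge, dif_pos h]
    rw [this]
    exact measurable_axialFn_pull lo _
  · have : (fun U : GaugeField P j G => axialGauge U lo hi s) = fun _ => 1 := by
      funext U; rw [axialGauge, dif_neg h]
    rw [this]
    exact measurable_const

/-- The torus axial gauge as a map into site functions `Site P j → G` (= `GaugeTransf P j G`, eta-expanded so that the product
σ-algebra on `Site P j → G` is the one found by instance search) is measurable. [folklore] -/
theorem measurable_axialGauge (lo hi : Fin P.d → ℤ) :
    Measurable fun U : GaugeField P j G => fun s : Site P j => axialGauge U lo hi s :=
  measurable_pi_lambda _ fun s => measurable_axialGauge_apply lo hi s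

/-- The conjugated direction `U ↦ (axialGauge U lo hi s)⁻¹ · c · axialGauge U lo hi s` is measurable (the row `hkm` for the
adapted family `k U t := (g U b.src)⁻¹ · e t · g U b.src` at each fixed `t`). [cite: Creutz2022, Ch. 11] -/
theorem measurable_conj_axialGauge (lo hi : Fin P.d → ℤ) (s : Site P j) (c : G) :
    Measurable fun U : GaugeField P j G => (axialGauge U lo hi s)⁻¹ * c * axialGauge U lo hi s :=
  ((measurable_axialGauge_apply lo hi s).inv.mul measurable_const).mul (measurable_axialGauge_apply lo hi s)

/-- ★ **THE DRESSED FIELD IS MEASURABLE**: `U ↦ U^{axialGauge U lo hi}` (`GaugeField.gaugeAct`) is a measurable self-map of the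
configuration space. [folklore] -/
theorem measurable_gaugeAct_axialGauge (lo hi : Fin P.d → ℤ) :
    Measurable fun U : GaugeField P j G => GaugeField.gaugeAct (axialGauge U lo hi) U := by
  refine measurable_pi_lambda _ fun b => ?_
  simp only [GaugeField.gaugeAct]
  exact ((measurable_axialGauge_apply lo hi b.src).mul (measurable_pi_apply b)).mul
    (measurable_axialGauge_apply lo hi b.tgt).inv

/-- Measurability of any observable read at the dressed field: `φ ∘ (U ↦ U^{axialGauge U})`. [folklore] -/
theorem measurable_comp_gaugeAct_axialGauge (lo hi : Fin P.d → ℤ) {β : Type*} [MeasurableSpace β]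
    {φ : GaugeField P j G → β} (hφ : Measurable φ) :
    Measurable fun U : GaugeField P j G => φ (GaugeField.gaugeAct (axialGauge U lo hi) U) :=
  hφ.comp (measurable_gaugeAct_axialGauge lo hi)

end Measurability

/-! ## §4  The dressed field is trivial on the comb (non-wrapping box) -/

section Comb

variable {P : Params} {j : ℕ} {G : Type*} [GaugeGroup G]

/-- **THE DRESSED FIELD IS `1` ON THE COMB**: on a non-wrapping box (`hi κ − lo κ < sitesPerDir j`), for every comb bond `b`,
`(U^{axialGauge U lo hi})(b) = 1` — ✓`gaugeAct_axialGauge_eq_one` (tree bonds `lowPart μ (x − lo) = 0` are exactly `1` in the axial gauge)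
read through the comb `combSet`. [cite: Balaban1985Averaging, p.24] -/
theorem gaugeAct_axialGauge_eq_one_of_mem_combSet (U : GaugeField P j G) {lo hi : Fin P.d → ℤ}
    (hN : ∀ κ, hi κ - lo κ < P.sitesPerDir j) {b : PBond P j} (hb : b ∈ combSet lo hi) :
    GaugeField.gaugeAct (axialGauge U lo hi) U b = 1 := by
  obtain ⟨x, hlo, hhi, hsrc, hlow⟩ := hb
  obtain ⟨s, μ⟩ := b
  simp only at hsrc hhi hlow
  subst hsrc
  exact gaugeAct_axialGauge_eq_one U hN hlo hhi hlow

/-- The dressed field agrees with the comb-fixed configuration on the comb: `(U^{axialGauge U})(b) = 1 = U[comb := 1](b)` there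
(bookkeeping twin for consumers phrased with `T4AxialGaugeFixing.fixBonds`). [cite: Balaban1985Averaging, p.24] -/
theorem gaugeAct_axialGauge_apply_eq_of_mem_combSet (U U' : GaugeField P j G) {lo hi : Fin P.d → ℤ}
    (hN : ∀ κ, hi κ - lo κ < P.sitesPerDir j) {b : PBond P j} (hb : b ∈ combSet lo hi) :
    GaugeField.gaugeAct (axialGauge U lo hi) U b = GaugeField.gaugeAct (axialGauge U' lo hi) U' b := by
  rw [gaugeAct_axialGauge_eq_one_of_mem_combSet U hN hb, gaugeAct_axialGauge_eq_one_of_mem_combSet U' hN hb]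

end Comb

end Summit.QuantumFields.YangMills.Theorems.UnitScaleGibbsAxialGaugeDocking

end
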